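import Literature.AnabelianGeometry.EtaleTheta.CyclotomeZHatAction
import Literature.AnabelianGeometry.AbsoluteAnabelian.ZHatCompletionAdicCompleteness
import Literature.IUT.HodgeTheaters.GlobalFrobenioidsCyclotomeIsoOfIntegralLawsNonVacuity
import Mathlib.RingTheory.Localization.FractionRing
import Mathlib.RingTheory.Polynomial.Basic
import Mathlib.Algebra.MvPolynomial.Rename
import Mathlib.Algebra.MvPolynomial.CommRing
import HarnessLib

/-!
# [IUTchI] Example 5.1 (v), pp. 127–129 — preliminaries for the NON-VACUITY WITNESS of the Kummer-rigidity
# law set (layer-5 certificate row `IUTchI:Ex5.1(v)`): the toy field `ℚ(x₀,x₁,x₂)` with `S₃` permuting the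
# variables, and three elementary facts about `Ẑ`

S. Mochizuki, *Inter-universal Teichmüller theory I*, kurims manuscript (May 2020), §5 Example 5.1 (v) pp. 127–129
([IUTchI] Ex 5.1 (v) pp.127–129) [claim: Mochizuki2012, status: disputed] (D-0012 claim key; nothing disputed is
asserted here; no side is taken on [IUTchIII] Cor. 3.12).  Cell abc-iut, sub-DAG `plan/L5/SUBDAG-IUTchI-Ex51.md`,
layer-5 certificate modules `Conditional/Layer5OfSEx51.lean` (`layer5_held_ex51v`, v0.1) and
`Conditional/Layer5OfSV02.lean` (`layer5_held_ex51v_v2`): their Ex 5.1 (v) conjuncts are derived from LAW binders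
((a) Kummer naturality, (b′) divisor transport, Rmk 3.1.7 pole/zero shape, `π₁^{rat/κ-sol}` moves an ∞κ×-coric
function, the torsion criterion).  abc-iut-w5-d110's `NFBridgeRecon.not_laws_of_commutative`
(`GlobalFrobenioidsCoricRigidityLawsCentral.lean`) shows that this law set has NO model with abelian `π₁^rat`; the
companion file `GlobalFrobenioidsCoricRigidityLawsNonVacuity.lean` shows that it DOES have a model — so the
certificate's Ex 5.1 (v) block is not vacuous — at the following TOY (label: TOY, a finite shadow of
"`Gal(L̄_C/L_C)` acting on rational functions with their divisors", NOT the arithmetic object):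

* the group is `S₃ = Equiv.Perm (Fin 3)` (non-abelian), the field of "rational functions" is
  `K = ℚ(x₀,x₁,x₂) = Frac ℚ[x₀,x₁,x₂]` with `S₃` permuting the variables (Mathlib's `MvPolynomial.renameEquiv`
  extended to the fraction field by `IsFractionRing.mulSemiringAction`);
* the "∞κ×-coric functions" are `S = {f₀, x₀, x₁, x₂}` with `f₀ = x₀ + x₁ + x₂` the unique `S₃`-fixed member (the
  "κ-coric" one), the variables forming one free `S₃`-orbit of "constants moved by `π₁^{rat/κ-sol}`".

This file proves the elementary facts about this toy used by the witness (`exists_toyField`: equivariance,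
`S · S ∩ S = ∅` — evaluation at `(2,2,2)` gives `{2,6}` on `S` and `{4,12,36}` on products —, `0 ∉ S`, the only
fixed member of `S` is `f₀`), and three facts about `Ẑ = completion ℤ`: `η 0 = 1`, `η a · η b = η(a+b)`, and "`η 1` has infinite order"
(from `CyclotomeIsoIntegralLawsToy.eta_injective`; commutativity of `Ẑ` is the tree's `ZHatCompletion.mul_comm`).  Classical bookkeeping;
PROOF-ONLY (no `def`, no `instance`, no new Prop fact).  typed ≠ proved elsewhere; a toy is not the genuine object.
-/

namespace Literature.IUT.HodgeTheaters

namespace CoricRigidityLawsToy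

open ProfiniteGrp ProfiniteGrp.ProfiniteCompletion
open Literature.AnabelianGeometry.EtaleTheta Literature.AnabelianGeometry.EtaleTheta.ZHatLevel

/-! ### Three facts about `Ẑ` (commutativity is the tree's `ZHatCompletion.mul_comm`) -/

/-- `η 0 = 1`. ([IUTchI] Ex 5.1 (v) p.127) [claim: Mochizuki2012, status: disputed] -/
theorem eta_zero : eta 0 = 1 := by
  rw [eta_eq_zpow 0, zpow_zero]

/-- `η a · η b = η (a + b)`. ([IUTchI] Ex 5.1 (v) p.127) [claim: Mochizuki2012, status: disputed] -/
theorem eta_mul (a b : ℤ) : eta a * eta b = eta (a + b) := by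
  rw [eta_eq_zpow a, eta_eq_zpow b, eta_eq_zpow (a + b), zpow_add]

/-- `η 1 ∈ Ẑ` has infinite order (`η` is injective). ([IUTchI] Ex 5.1 (v) p.127) [claim: Mochizuki2012, status: disputed] -/
theorem not_isOfFinOrder_eta_one : ¬ IsOfFinOrder (eta 1) := by
  rw [isOfFinOrder_iff_pow_eq_one]
  rintro ⟨n, hn, h⟩
  have h' : eta (n : ℤ) = eta 0 := by
    rw [eta_eq_zpow (n : ℤ), zpow_natCast, h, eta_zero]
  have := CyclotomeIsoIntegralLawsToy.eta_injective h'
  omega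

/-! ### The toy field `ℚ(x₀,x₁,x₂)` with `S₃` permuting the variables -/

/-- Renaming variables along permutations is a homomorphism `S₃ → Aut_ℚ(ℚ[x₀,x₁,x₂])`.
([IUTchI] Ex 5.1 (v) p.127) [claim: Mochizuki2012, status: disputed] -/
theorem exists_renameHom : ∃ ρ : Equiv.Perm (Fin 3) →* (MvPolynomial (Fin 3) ℚ ≃ₐ[ℚ] MvPolynomial (Fin 3) ℚ),
    ∀ σ p, ρ σ p = MvPolynomial.rename σ p :=
  ⟨{ toFun := fun σ => MvPolynomial.renameEquiv ℚ σ
     map_one' := MvPolynomial.renameEquiv_refl ℚ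
     map_mul' := fun σ τ => by
       apply AlgEquiv.ext
       intro p
       simp [MvPolynomial.renameEquiv, MvPolynomial.rename_rename, Equiv.Perm.coe_mul] },
   fun _ _ => rfl⟩

/-- Evaluation at `(2,2,2)` of a variable is `2`. ([IUTchI] Ex 5.1 (v) p.127) [claim: Mochizuki2012, status: disputed] -/
theorem eval_two_X (i : Fin 3) :
    MvPolynomial.eval (fun _ : Fin 3 => (2 : ℚ)) (MvPolynomial.X i) = 2 := MvPolynomial.eval_X _

/-- Evaluation at `(2,2,2)` of `x₀ + x₁ + x₂` is `6`. ([IUTchI] Ex 5.1 (v) p.127) [claim: Mochizuki2012, status: disputed] -/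
theorem eval_two_sum :
    MvPolynomial.eval (fun _ : Fin 3 => (2 : ℚ)) (∑ i : Fin 3, MvPolynomial.X i) = 6 := by
  rw [map_sum]
  simp only [MvPolynomial.eval_X, Finset.sum_const, Finset.card_univ, Fintype.card_fin]
  norm_num

/-- Renaming variables fixes `x₀ + x₁ + x₂`. ([IUTchI] Ex 5.1 (v) p.127) [claim: Mochizuki2012, status: disputed] -/
theorem rename_sum (σ : Equiv.Perm (Fin 3)) :
    MvPolynomial.rename σ (∑ i : Fin 3, (MvPolynomial.X i : MvPolynomial (Fin 3) ℚ)) =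
      ∑ i : Fin 3, MvPolynomial.X i := by
  rw [map_sum]
  simp only [MvPolynomial.rename_X]
  exact Equiv.sum_comp σ (fun i => (MvPolynomial.X i : MvPolynomial (Fin 3) ℚ))

/-- In `Fin 3`, given `j ≠ i` there is a third index. ([IUTchI] Ex 5.1 (v) p.127) [claim: Mochizuki2012, status: disputed] -/
theorem fin3_third : ∀ i j : Fin 3, j ≠ i → ∃ k : Fin 3, k ≠ i ∧ k ≠ j := by decide

/-- In `Fin 3`, every index has another one. ([IUTchI] Ex 5.1 (v) p.127) [claim: Mochizuki2012, status: disputed] -/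
theorem fin3_other : ∀ i : Fin 3, ∃ j : Fin 3, j ≠ i := by decide

/-- **The toy field.**  There are a field `K` [`= ℚ(x₀,x₁,x₂)`] with an action of `S₃` by ring automorphisms, an
`S₃`-fixed element `f₀` [`= x₀+x₁+x₂`] and an injective family `x : Fin 3 → K` permuted by `S₃` [the variables], such
that, for `S = {f₀} ∪ {x₀,x₁,x₂}`: no `xᵢ` equals `f₀`, no product of two members of `S` lies in `S`, `0 ∉ S`, and
`f₀` is the only member of `S` fixed by all of `S₃`. ([IUTchI] Ex 5.1 (v) p.127) [claim: Mochizuki2012, status: disputed] -/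
theorem exists_toyField : ∃ (K : Type) (_ : Field K) (_ : MulSemiringAction (Equiv.Perm (Fin 3)) K)
    (f0 : K) (XK : Fin 3 → K),
    (∀ (σ : Equiv.Perm (Fin 3)) (i : Fin 3), σ • XK i = XK (σ i)) ∧
    (∀ σ : Equiv.Perm (Fin 3), σ • f0 = f0) ∧
    (∀ i j : Fin 3, XK i = XK j → i = j) ∧
    (∀ i : Fin 3, XK i ≠ f0) ∧
    (∀ s ∈ insert f0 (Set.range XK), ∀ t ∈ insert f0 (Set.range XK), s * t ∉ insert f0 (Set.range XK)) ∧
    (0 : K) ∉ insert f0 (Set.range XK) ∧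
    (∀ s ∈ insert f0 (Set.range XK), (∀ σ : Equiv.Perm (Fin 3), σ • s = s) → s = f0) := by
  let A := MvPolynomial (Fin 3) ℚ
  let K := FractionRing A
  obtain ⟨ρ, hρ⟩ := exists_renameHom
  letI actA : MulSemiringAction (Equiv.Perm (Fin 3)) A := MulSemiringAction.compHom A ρ
  have hsmulA : ∀ (σ : Equiv.Perm (Fin 3)) (p : A), σ • p = MvPolynomial.rename σ p :=
    fun σ p => hρ σ p
  letI actK : MulSemiringAction (Equiv.Perm (Fin 3)) K := IsFractionRing.mulSemiringAction _ A K
  have hsmulK : ∀ (σ : Equiv.Perm (Fin 3)) (p : A), σ • algebraMap A K p = algebraMap A K (σ • p) :=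
    fun σ p => IsFractionRing.ringEquivOfRingEquiv_algebraMap (MulSemiringAction.toRingEquiv _ A σ) p
  let XK : Fin 3 → K := fun i => algebraMap A K (MvPolynomial.X i)
  let f0 : K := algebraMap A K (∑ i : Fin 3, MvPolynomial.X i)
  have hinjK : Function.Injective (algebraMap A K) := IsFractionRing.injective A K
  have hXK_smul : ∀ (σ : Equiv.Perm (Fin 3)) (i : Fin 3), σ • XK i = XK (σ i) := by
    intro σ i
    change σ • algebraMap A K (MvPolynomial.X i) = algebraMap A K _
    rw [hsmulK, hsmulA, MvPolynomial.rename_X]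
  have hf0_smul : ∀ σ : Equiv.Perm (Fin 3), σ • f0 = f0 := by
    intro σ
    change σ • algebraMap A K _ = algebraMap A K _
    rw [hsmulK, hsmulA, rename_sum]
  have hXK_inj : ∀ i j : Fin 3, XK i = XK j → i = j := fun i j h =>
    MvPolynomial.X_injective (hinjK h)
  have hXK_ne_f0 : ∀ i : Fin 3, XK i ≠ f0 := by
    intro i h
    have h' := congrArg (MvPolynomial.eval (fun _ : Fin 3 => (2 : ℚ))) (hinjK h)
    rw [eval_two_X, eval_two_sum] at h'
    norm_num at h'
  -- every member of `S` is the image of a polynomial with value 2 or 6 at (2,2,2)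
  have hS_val : ∀ s ∈ insert f0 (Set.range XK), ∃ a : A, s = algebraMap A K a ∧
      (MvPolynomial.eval (fun _ : Fin 3 => (2 : ℚ)) a = 2 ∨
        MvPolynomial.eval (fun _ : Fin 3 => (2 : ℚ)) a = 6) := by
    intro s hs
    rcases hs with rfl | ⟨i, rfl⟩
    · exact ⟨_, rfl, Or.inr eval_two_sum⟩
    · exact ⟨_, rfl, Or.inl (eval_two_X i)⟩
  refine ⟨K, inferInstance, actK, f0, XK, hXK_smul, hf0_smul, hXK_inj, hXK_ne_f0, ?_, ?_, ?_⟩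
  · -- products take the values 4, 12, 36 at (2,2,2)
    intro s hs t ht hst
    obtain ⟨a, rfl, ha⟩ := hS_val s hs
    obtain ⟨b, rfl, hb⟩ := hS_val t ht
    obtain ⟨c, hc, hc'⟩ := hS_val _ hst
    rw [← map_mul] at hc
    have h' := congrArg (MvPolynomial.eval (fun _ : Fin 3 => (2 : ℚ))) (hinjK hc)
    rw [map_mul] at h'
    rcases ha with ha | ha <;> rcases hb with hb | hb <;> rcases hc' with hc' | hc' <;>
      rw [ha, hb, hc'] at h' <;> norm_num at h'
  · intro h0
    obtain ⟨a, ha, ha'⟩ := hS_val 0 h0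
    have h' := congrArg (MvPolynomial.eval (fun _ : Fin 3 => (2 : ℚ))) (hinjK ((map_zero _).trans ha))
    rw [map_zero] at h'
    rcases ha' with ha' | ha' <;> rw [ha'] at h' <;> norm_num at h'
  · -- a variable is moved by a transposition
    intro s hs hfix
    rcases hs with rfl | ⟨i, rfl⟩
    · rfl
    · exfalso
      obtain ⟨j, hj⟩ := fin3_other i
      have h := hfix (Equiv.swap i j)
      rw [hXK_smul, Equiv.swap_apply_left] at h
      exact hj (hXK_inj _ _ h)

end CoricRigidityLawsToy

end Literature.IUT.HodgeTheaters
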